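import Mathlib
import Literature.MathematicalPhysics.StatisticalMechanics.Crystallization
import Literature.MathematicalPhysics.StatisticalMechanics.BarlowStacking
import Literature.MathematicalPhysics.StatisticalMechanics.HaggStacking

/-!
# Sketch — crux-ideate round 1, ideator 1, crux `UniformPolytypeStability` (stmt-AtomisticToContinuum-15800)

First lemmas of the two idea cards (signatures only; `sorry` bodies).
-/

namespace Summit.AtomisticToContinuum.Crystallization.Cruxes.UniformPolytypeStability.Ideator1

open Literature.MathematicalPhysics.StatisticalMechanics

/-! ### Card `layer-transfer-storage-certificate` — the S-procedure / telescoping step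

Local dissipation inequalities with LAYER-INDEXED storage forms `T m` (in the card: `T m = T_{w(m)}`, the storage
matrix attached to the letter window of the Hägg word at layer `m`) telescope to the global inequality for every
finitely supported displacement — for EVERY coefficient sequence, i.e. uniformly in the word. -/

/-- Storage-function telescoping (discrete dissipation inequality ⇒ global coercivity), word-uniform. -/
theorem storage_telescope {E : Type*} [AddCommGroup E] [Module ℝ E]
    (W Nf : ℤ → E → E → ℝ) (T : ℤ → E → ℝ) (κ : ℝ)
    (hT : ∀ m, T m 0 = 0)
    (hloc : ∀ m x y, κ * Nf m x y ≤ W m x y + T m x - T (m + 1) y)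
    (u : ℤ → E) (n : ℕ) (hu : ∀ m, u m ≠ 0 → |m| ≤ n) :
    κ * ∑ m ∈ Finset.Icc (-(n : ℤ) - 1) (n + 1), Nf m (u m) (u (m + 1))
      ≤ ∑ m ∈ Finset.Icc (-(n : ℤ) - 1) (n + 1), W m (u m) (u (m + 1)) := by
  sorry

/-- Memory-2 version (stage forms see three consecutive layers, storage forms see two): the shape actually used
for Lennard-Jones truncated at range `R_c < 3·(39/50)·(47/50)` (interactions reach second-nearest layers only). -/
theorem storage_telescope₂ {E : Type*} [AddCommGroup E] [Module ℝ E]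
    (W Nf : ℤ → E → E → E → ℝ) (T : ℤ → E → E → ℝ) (κ : ℝ)
    (hT : ∀ m, T m 0 0 = 0)
    (hloc : ∀ m x y z, κ * Nf m x y z ≤ W m x y z + T m x y - T (m + 1) y z)
    (u : ℤ → E) (n : ℕ) (hu : ∀ m, u m ≠ 0 → |m| ≤ n) :
    κ * ∑ m ∈ Finset.Icc (-(n : ℤ) - 2) (n + 2), Nf m (u m) (u (m + 1)) (u (m + 2))
      ≤ ∑ m ∈ Finset.Icc (-(n : ℤ) - 2) (n + 2), W m (u m) (u (m + 1)) (u (m + 2)) := by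
  sorry

/-! ### Card `constant-stress-gap-pinning` — force balance as a conservation law

(B0) Under force balance the normal stress transmitted across the plane between layers `m` and `m+1` does not
depend on `m` (discrete divergence form of equilibrium); (B1) the adjacent-layer part of that stress is a strictly
monotone function of the gap on the crux's box, with slope ≥ 5 (kit j024225: 6.67 at `a = 1`). -/

/-- (B0) Constant transmitted stress. `f i j` = normal force per unit cell exerted by layer `i` on layer `j`
(antisymmetric); force balance of every layer ⇒ the straddling sum `P m = Σ_{i ≤ m < j} f i j` is independent of `m`. -/
theorem transmittedStress_succ (f : ℤ → ℤ → ℝ) (hf : ∀ i j, f i j = -f j i)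
    (hP : ∀ m : ℤ, Summable (fun p : {p : ℤ × ℤ // p.1 ≤ m ∧ m < p.2} => f p.1.1 p.1.2))
    (hF : ∀ ℓ : ℤ, Summable (fun i : ℤ => f i ℓ))
    (hbal : ∀ ℓ : ℤ, ∑' i : ℤ, f i ℓ = 0) (m : ℤ) :
    ∑' p : {p : ℤ × ℤ // p.1 ≤ m + 1 ∧ m + 1 < p.2}, f p.1.1 p.1.2
      = ∑' p : {p : ℤ × ℤ // p.1 ≤ m ∧ m < p.2}, f p.1.1 p.1.2 := by
  sorry

/-- The adjacent-layer transmitted normal force per unit cell of a Barlow bilayer with in-layer spacing `a` and gap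
`h`: `g(a,h) = Σ_{(i,j) ∈ ℤ²} (−V'(r_ij)) · h / r_ij`, `r_ij = ‖i v₁ + j v₂ + w + h e₃‖` (`w` = `barlowOffset a`; the
other letter gives the same value by the in-plane point reflection). -/
noncomputable def adjacentNormalForce (a h : ℝ) : ℝ :=
  ∑' ij : ℤ × ℤ,
    (-(deriv lennardJones
        ‖((ij.1 : ℝ) • triangularVec₁ a) + ((ij.2 : ℝ) • triangularVec₂ a) + barlowOffset a + layerNormal h‖)) *
      (h / ‖((ij.1 : ℝ) • triangularVec₁ a) + ((ij.2 : ℝ) • triangularVec₂ a) + barlowOffset a + layerNormal h‖)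

/-- (B1) Strict monotonicity of the adjacent-layer normal force on the crux's box, with an explicit slope
(a certified interval computation: the slope is minus the `zz` interlayer stiffness, ≈ −6.7 at `a = 1`). -/
theorem adjacentNormalForce_slope (a : ℝ) (ha : 47 / 50 ≤ a) (ha' : a ≤ 1) (h h' : ℝ)
    (hh : 39 / 50 * a ≤ h) (hhh' : h < h') (hh' : h' ≤ 17 / 20 * a) :
    adjacentNormalForce a h' + 5 * (h' - h) ≤ adjacentNormalForce a h := by
  sorry

/-- (B2, the pinning conclusion in the crux's own variables) For a force-balanced layered set in the box, all gaps
lie within `1/500` of each other.  Stated over the crux's `Sites`/force-balance text: `a, s, z` as in the crux. -/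
theorem gap_pinning (a : ℝ) (s : ℤ → ℤ) (z : ℤ → ℝ) (ha : 47 / 50 ≤ a) (ha' : a ≤ 1) (hs : IsHaggSeq s)
    (hz : ∀ m : ℤ, 39 / 50 * a ≤ z (m + 1) - z m ∧ z (m + 1) - z m ≤ 17 / 20 * a)
    (hbal : let Sites : Set (EuclideanSpace ℝ (Fin 3)) := {p | ∃ m i j : ℤ, p = ((i : ℝ) • triangularVec₁ a) +
        ((j : ℝ) • triangularVec₂ a) + ((haggLabel s m : ℝ) • barlowOffset a) + (z m • layerNormal 1)};
      ∀ p ∈ Sites, HasSum (fun q : {q : EuclideanSpace ℝ (Fin 3) // q ∈ Sites ∧ q ≠ p} =>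
        (deriv lennardJones (dist p q.1) / dist p q.1) • (p - q.1)) 0) :
    ∀ m m' : ℤ, |(z (m + 1) - z m) - (z (m' + 1) - z m')| ≤ 1 / 500 := by
  sorry

end Summit.AtomisticToContinuum.Crystallization.Cruxes.UniformPolytypeStability.Ideator1
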